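import Summits.Ventures.PercRepro.ProfilePointedCircuitClassesStarSharpV

/-!
# PercRepro — CASE D0 OF `StarNineSharp`, PART B: THE «NO ON LINE» REGIME WITHOUT AN ON PLANE THROUGH `e, f`
(p5, gen 54; `proofs/P5-GM1.md` §81 (c), rules R2 / R3)

Setting: `E₇ := E − b − b′`, `X := E₇ − e − f`, ON(`S`) ⟺ `ρ(S ∪ {b, b′}) = ρ(S) + 1`.  Hypotheses: every line of
`R = N ∖ {b, b′}` is OFF (`hnl`: a subset of `E₇` with `ρ(S ∪ {b, b′}) ≤ 3` has rank `≤ 1`), `e` is simple on `X`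
(`ρ{e, y} = 2`), `ρ(X) = 4` (`{e, f}` is not a series pair), and every rank-`3` subset of `E₇` through `e` and `f` is
OFF (`hef`: no ON plane contains both).  Then (F1′, `rk_inter_le_one_of_two_on`) two ON sets of rank `3` whose
union has rank `4` meet in rank `≤ 1`, and an ON demand `π + e + b` (`π ⊆ X` a pair) has `ρ(π + e + f) = 4`,
so `X − π ∈ A`; it is mapped to the bi-basis `π + e + f` when `X − π` is OFF (rule R2) and to `{e, f, x} + b` for an
`x ∈ π` with `{e, f, x} + b ∈ BI_4(N)` OFF when `X − π` is ON (rule R3: `r3_point_exists`; if two demands share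
the image point `x` then both complements `{y₁} ∪ W`, `{y₂} ∪ W` are ON, F1′ gives `ρ(W) ≤ 1` and `ρ(X − x) ≤ 3`,
contradicting `{e, f, x} + b ∈ BI_4(N)`: `r3_injective`).  With the OFF injection of D0A the three target kinds (assembled in part C)
(OFF, avoiding `e` / `e ∈ W ∌ b` / `e, b ∈ W`) are disjoint, whence **`inCount_thru_le_of_no_on_line_no_ef`** (this
regime: 46,018 + 66,589 of the 191,842 D0 configurations of the catalogue, §81).
-/

open scoped Matroid

namespace PercRepro.Cogirth

open Finset ThmH Skew Shadow Profile

variable {α : Type} [DecidableEq α] {N : Matroid α} [N.Finite]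

section StarSharpD0B

variable {b b' : α}

/-- Submodularity with a sub-intersection (copy of StarSharpX's lemma): `ρ(S ∪ T) + ρ(I) ≤ ρ(S) + ρ(T)` for
`I ⊆ S ∩ T`. -/
theorem rk_union_add_rk_le_of_subset_inter' {S T I : Finset α} (hI : I ⊆ S ∩ T) :
    rk N (S ∪ T) + rk N I ≤ rk N S + rk N T := by
  have h1 := rk_inter_add_rk_union_le' (M := N) S T
  have h2 : rk N I ≤ rk N (S ∩ T) := rk_mono' (M := N) hI
  omega

/-- `ρ(S ∪ {b, b′}) ∈ {ρ(S) + 1, ρ(S) + 2}` for `S ⊆ E₇` (the series pair `{b, b′}`). -/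
theorem rk_insert_bb'_bounds (h : SeriesPair N b b') {S : Finset α} (hS : S ⊆ ((gr N).erase b).erase b') :
    rk N S + 1 ≤ rk N (insert b (insert b' S)) ∧ rk N (insert b (insert b' S)) ≤ rk N S + 2 := by
  have hb : b ∈ gr N := h.1; have hb' : b' ∈ gr N := h.2.1
  have h1 : rk N (insert b S) = rk N S + 1 := rk_insert_left_eq_add_one_of_seriesPair h hS
  have hSg : S ⊆ gr N := hS.trans ((erase_subset _ _).trans (erase_subset _ _))
  have e2 : insert b (insert b' S) = insert b' (insert b S) := by ext x; simp only [mem_insert]; tauto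
  have h2 : rk N (insert b' (insert b S)) ≤ rk N (insert b S) + 1 := rk_insert_le_add_one hb' (insert_subset hb hSg)
  have h3 : rk N (insert b S) ≤ rk N (insert b' (insert b S)) := rk_mono' (M := N) (subset_insert _ _)
  rw [e2]; omega

/-- **F1′ — TWO ON SETS MEETING IN RANK ≥ 2 FORCE AN ON LINE**: if no line of `R` is ON (`hnl`), two subsets
`S₁, S₂ ⊆ E₇` with `ρ(S_i ∪ {b, b′}) = 4` and `ρ(S₁ ∪ S₂) = 4` satisfy `ρ(S₁ ∩ S₂) ≤ 1`. -/
theorem rk_inter_le_one_of_two_on (h : SeriesPair N b b') (hR : rk N (gr N) = 5)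
    (hnl : ∀ S : Finset α, S ⊆ ((gr N).erase b).erase b' → rk N (insert b (insert b' S)) ≤ 3 → rk N S ≤ 1)
    {S₁ S₂ : Finset α} (hS₁ : S₁ ⊆ ((gr N).erase b).erase b') (hS₂ : S₂ ⊆ ((gr N).erase b).erase b')
    (hon₁ : rk N (insert b (insert b' S₁)) = 4) (hon₂ : rk N (insert b (insert b' S₂)) = 4)
    (hU : rk N (S₁ ∪ S₂) = 4) : rk N (S₁ ∩ S₂) ≤ 1 := by
  have hU' : rk N (insert b (insert b' (S₁ ∪ S₂))) = 5 := by
    have := rk_insert_bb'_bounds h (union_subset hS₁ hS₂)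
    have h5 : rk N (insert b (insert b' (S₁ ∪ S₂))) ≤ 5 := by
      rw [← hR]
      exact rk_mono' (M := N) (insert_subset h.1 (insert_subset h.2.1
        ((union_subset hS₁ hS₂).trans ((erase_subset _ _).trans (erase_subset _ _)))))
    omega
  have hsub := rk_inter_add_rk_union_le' (M := N) (insert b (insert b' S₁)) (insert b (insert b' S₂))
  have e1 : insert b (insert b' S₁) ∩ insert b (insert b' S₂) = insert b (insert b' (S₁ ∩ S₂)) := by
    ext x; simp only [mem_inter, mem_insert]; tauto
  have e2 : insert b (insert b' S₁) ∪ insert b (insert b' S₂) = insert b (insert b' (S₁ ∪ S₂)) := by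
    ext x; simp only [mem_union, mem_insert]; tauto
  rw [e1, e2, hU', hon₁, hon₂] at hsub
  exact hnl _ ((inter_subset_left).trans hS₁) (by omega)

/-- `ρ(S ∪ {b, b′}) = 5` for `S ⊆ E₇` of rank `3` that is not ON. -/
theorem rk_insert_bb'_eq_five_of_not_on (h : SeriesPair N b b') {S : Finset α}
    (hS : S ⊆ ((gr N).erase b).erase b') (hS3 : rk N S = 3) (hnot : ¬ rk N (insert b (insert b' S)) = 4) :
    rk N (insert b (insert b' S)) = 5 := by
  have := rk_insert_bb'_bounds h hS
  omega

/-! ### The demands `π + e + b` with `X − π` ON: the point of rule R3 -/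

/-- The complement of `π + e` in `E₇` is `(X ∖ π) + f`, for `π ⊆ X := E₇ − f − e`. -/
theorem E7_sdiff_insert_e_eq {e f : α} (hf : f ∈ gr N) (hef : e ≠ f) (hfb : f ≠ b) (hfb' : f ≠ b') {π : Finset α}
    (hπ : π ⊆ ((((gr N).erase b).erase b').erase f).erase e) :
    ((gr N).erase b).erase b' \ insert e π = insert f (((((gr N).erase b).erase b').erase f).erase e \ π) := by
  ext x
  simp only [mem_sdiff, mem_insert, mem_erase, not_or]
  constructor
  · rintro ⟨⟨hxb', hxb, hxg⟩, hxe, hxπ⟩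
    by_cases hxf : x = f
    · exact Or.inl hxf
    · exact Or.inr ⟨⟨hxe, hxf, hxb', hxb, hxg⟩, hxπ⟩
  · rintro (rfl | ⟨⟨hxe, hxf, hxb', hxb, hxg⟩, hxπ⟩)
    · exact ⟨⟨hfb', hfb, hf⟩, hef.symm, fun h' => (mem_erase.1 (mem_erase.1 (hπ h')).2).1 rfl⟩
    · exact ⟨⟨hxb', hxb, hxg⟩, hxe, hxπ⟩

/-- The complement of `π + e + f` in `E₇` is `X ∖ π`. -/
theorem E7_sdiff_insert_ef_eq (e f : α) (π : Finset α) :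
    ((gr N).erase b).erase b' \ insert f (insert e π) = ((((gr N).erase b).erase b').erase f).erase e \ π := by
  ext x
  simp only [mem_sdiff, mem_insert, mem_erase, not_or]
  constructor
  · rintro ⟨⟨hxb', hxb, hxg⟩, hxf, hxe, hxπ⟩
    exact ⟨⟨hxe, hxf, hxb', hxb, hxg⟩, hxπ⟩
  · rintro ⟨⟨hxe, hxf, hxb', hxb, hxg⟩, hxπ⟩
    exact ⟨⟨hxb', hxb, hxg⟩, hxf, hxe, hxπ⟩

/-- The complement of `{e, f, x}` in `E₇` is `X − x`, for `x ∈ X`. -/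
theorem E7_sdiff_efx_eq (e f x : α) :
    ((gr N).erase b).erase b' \ {e, f, x} = (((((gr N).erase b).erase b').erase f).erase e).erase x := by
  ext y
  simp only [mem_sdiff, mem_insert, mem_singleton, mem_erase, not_or]
  constructor
  · rintro ⟨⟨hyb', hyb, hyg⟩, hye, hyf, hyx⟩
    exact ⟨hyx, hye, hyf, hyb', hyb, hyg⟩
  · rintro ⟨hyx, hye, hyf, hyb', hyb, hyg⟩
    exact ⟨⟨hyb', hyb, hyg⟩, hye, hyf, hyx⟩

/-- `{e, f, x} ∪ (π + e) = π + e + f` for `π = {x, y}` (set identities used by `r3_point_exists`, proved outside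
the main context). -/
theorem union_efx_insert_e_pair (e f x y : α) :
    ({e, f, x} : Finset α) ∪ insert e {x, y} = insert f (insert e {x, y}) := by
  ext w; simp only [mem_union, mem_insert, mem_singleton]; tauto

/-- `{e, f, y} ∪ (π + e) = π + e + f` for `π = {x, y}`. -/
theorem union_efy_insert_e_pair (e f x y : α) :
    ({e, f, y} : Finset α) ∪ insert e {x, y} = insert f (insert e {x, y}) := by
  ext w; simp only [mem_union, mem_insert, mem_singleton]; tauto

/-- `{e, x} ⊆ {e, f, x} ∩ (π + e)` for `π = {x, y}`. -/
theorem pair_ex_subset_inter (e f x y : α) : ({e, x} : Finset α) ⊆ {e, f, x} ∩ insert e {x, y} := by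
  intro w hw; simp only [mem_insert, mem_singleton, mem_inter] at hw ⊢; tauto

/-- `{e, y} ⊆ {e, f, y} ∩ (π + e)` for `π = {x, y}`. -/
theorem pair_ey_subset_inter (e f x y : α) : ({e, y} : Finset α) ⊆ {e, f, y} ∩ insert e {x, y} := by
  intro w hw; simp only [mem_insert, mem_singleton, mem_inter] at hw ⊢; tauto

/-- **THE POINT OF RULE R3**: let `π = {x, y} ⊆ X` with `π + e` of rank `3`, `(X ∖ π) + f` of rank `4`,
`π + e` ON, `ρ(π + e + f) = 4` and `X ∖ π` ON.  Then some `x ∈ π` has `ρ{e, f, x} = 3`, `ρ(X − x) = 4` and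
`{e, f, x}` OFF. -/
theorem r3_point_exists (h : SeriesPair N b b') (hn : (gr N).card = 9) (hR : rk N (gr N) = 5)
    (hnl : ∀ S : Finset α, S ⊆ ((gr N).erase b).erase b' → rk N (insert b (insert b' S)) ≤ 3 → rk N S ≤ 1)
    {e f : α} (he : e ∈ gr N) (hf : f ∈ gr N) (hef : e ≠ f) (heb : e ≠ b) (heb' : e ≠ b') (hfb : f ≠ b) (hfb' : f ≠ b')
    (he1 : ∀ y ∈ ((((gr N).erase b).erase b').erase f).erase e, rk N {e, y} = 2)
    (hX : rk N (((((gr N).erase b).erase b').erase f).erase e) = 4)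
    {π : Finset α} (hπ : π ⊆ ((((gr N).erase b).erase b').erase f).erase e) (hπ2 : π.card = 2)
    (hYc : rk N (insert f (((((gr N).erase b).erase b').erase f).erase e \ π)) = 4)
    (hYon : rk N (insert b (insert b' (insert e π))) = 4)
    (hef4 : rk N (insert f (insert e π)) = 4)
    (hcon : rk N (insert b (insert b' (((((gr N).erase b).erase b').erase f).erase e \ π))) = 4) :
    ∃ x ∈ π, rk N {e, f, x} = 3 ∧ rk N ((((((gr N).erase b).erase b').erase f).erase e).erase x) = 4 ∧
      rk N (insert b (insert b' {e, f, x})) = 5 := by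
  have _ := hcon
  set X := ((((gr N).erase b).erase b').erase f).erase e with hXdef
  have hXE : X ⊆ ((gr N).erase b).erase b' := (erase_subset _ _).trans (erase_subset _ _)
  have hπE : π ⊆ ((gr N).erase b).erase b' := hπ.trans hXE
  have heE : e ∈ ((gr N).erase b).erase b' := mem_erase.2 ⟨heb', mem_erase.2 ⟨heb, he⟩⟩
  have hfE : f ∈ ((gr N).erase b).erase b' := mem_erase.2 ⟨hfb', mem_erase.2 ⟨hfb, hf⟩⟩
  have hE7 : (((gr N).erase b).erase b').card = 7 := by
    rw [card_erase_of_mem (mem_erase.2 ⟨h.2.2.1.symm, h.2.1⟩), card_erase_of_mem h.1, hn]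
  have hXc : X.card = 5 := by
    rw [hXdef, card_erase_of_mem (mem_erase.2 ⟨hef, heE⟩), card_erase_of_mem hfE, hE7]
  obtain ⟨x, y, hxy, rfl⟩ := card_eq_two.1 hπ2
  have hxX : x ∈ X := hπ (mem_insert_self _ _)
  have hyX : y ∈ X := hπ (mem_insert_of_mem (mem_singleton_self _))
  have hxe : x ≠ e := fun h' => (mem_erase.1 hxX).1 h'
  have hye : y ≠ e := fun h' => (mem_erase.1 hyX).1 h'
  have hxf : x ≠ f := fun h' => (mem_erase.1 (mem_erase.1 hxX).2).1 h'
  have hyf : y ≠ f := fun h' => (mem_erase.1 (mem_erase.1 hyX).2).1 h'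
  -- every 3-subset of `{e, f, x, y}` (rank 4 = card) has rank 3
  have hfn : f ∉ insert e ({x, y} : Finset α) := by
    simp only [mem_insert, mem_singleton, not_or]; exact ⟨hef.symm, hxf.symm, hyf.symm⟩
  have hen : e ∉ ({x, y} : Finset α) := by
    simp only [mem_insert, mem_singleton, not_or]; exact ⟨hxe.symm, hye.symm⟩
  have hcard4 : (insert f (insert e ({x, y} : Finset α))).card = 4 := by
    rw [card_insert_of_notMem hfn, card_insert_of_notMem hen, card_pair hxy]
  have hfull : rk N (insert f (insert e ({x, y} : Finset α))) = (insert f (insert e ({x, y} : Finset α))).card := by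
    rw [hef4, hcard4]
  have hefx : rk N {e, f, x} = 3 := by
    have := rk_eq_card_of_subset_of_rk_eq_card (M := N) (X := {e, f, x}) (by
      intro z hz; simp only [mem_insert, mem_singleton] at hz ⊢; tauto) hfull
    have hn' : e ∉ ({f, x} : Finset α) := by
      simp only [mem_insert, mem_singleton, not_or]; exact ⟨hef, hxe.symm⟩
    rw [this, card_insert_of_notMem hn', card_pair hxf.symm]
  have hefy : rk N {e, f, y} = 3 := by
    have := rk_eq_card_of_subset_of_rk_eq_card (M := N) (X := {e, f, y}) (by
      intro z hz; simp only [mem_insert, mem_singleton] at hz ⊢; tauto) hfull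
    have hn' : e ∉ ({f, y} : Finset α) := by
      simp only [mem_insert, mem_singleton, not_or]; exact ⟨hef, hye.symm⟩
    rw [this, card_insert_of_notMem hn', card_pair hyf.symm]
  -- OFF: `{e, f, z}` ON together with `π + e` ON would force the line `{e, z}` (F1′)
  have key : ∀ z, z ∈ X → rk N {e, f, z} = 3 →
      ({e, f, z} : Finset α) ∪ insert e {x, y} = insert f (insert e {x, y}) →
      ({e, z} : Finset α) ⊆ {e, f, z} ∩ insert e {x, y} → rk N (insert b (insert b' {e, f, z})) = 5 := by
    intro z hzX hefz e1 hsub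
    have hzE : z ∈ ((gr N).erase b).erase b' := hXE hzX
    have hzS : ({e, f, z} : Finset α) ⊆ ((gr N).erase b).erase b' := by
      intro w hw; simp only [mem_insert, mem_singleton] at hw
      rcases hw with rfl | rfl | rfl <;> assumption
    apply rk_insert_bb'_eq_five_of_not_on h hzS hefz
    intro hon
    have hU : rk N ({e, f, z} ∪ insert e {x, y}) = 4 := by rw [e1, hef4]
    have hI := rk_inter_le_one_of_two_on h hR hnl hzS (insert_subset heE hπE) hon hYon hU
    have hez : rk N {e, z} ≤ rk N ({e, f, z} ∩ insert e {x, y}) := rk_mono' (M := N) hsub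
    have := he1 z hzX
    omega
  have hoffx : rk N (insert b (insert b' {e, f, x})) = 5 := by
    exact key x hxX hefx (union_efx_insert_e_pair e f x y) (pair_ex_subset_inter e f x y)
  have hoffy : rk N (insert b (insert b' {e, f, y})) = 5 := by
    exact key y hyX hefy (union_efy_insert_e_pair e f x y) (pair_ey_subset_inter e f x y)
  -- one of `X − x`, `X − y` has rank 4: submodularity on `S + x`, `S + y` with `S := X ∖ π`
  have hSc : (X \ {x, y}).card = 3 := by rw [card_sdiff_of_subset hπ, hXc, hπ2]
  have hS3 : rk N (X \ {x, y}) = 3 := by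
    have hc : (insert f (X \ {x, y})).card = 4 := by
      rw [card_insert_of_notMem (fun h' => (mem_erase.1 (mem_erase.1 (mem_sdiff.1 h').1).2).1 rfl), hSc]
    rw [rk_eq_card_of_subset_of_rk_eq_card (M := N) (subset_insert f _) (by rw [hYc, hc]), hSc]
  have hxS : x ∉ X \ {x, y} := fun h' => (mem_sdiff.1 h').2 (mem_insert_self _ _)
  have hyS : y ∉ X \ {x, y} := fun h' => (mem_sdiff.1 h').2 (mem_insert_of_mem (mem_singleton_self _))
  have eXx : X.erase x = insert y (X \ {x, y}) := by
    ext w; simp only [mem_erase, mem_insert, mem_sdiff, mem_singleton, not_or]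
    constructor
    · rintro ⟨hwx, hwX⟩
      by_cases hwy : w = y
      · exact Or.inl hwy
      · exact Or.inr ⟨hwX, hwx, hwy⟩
    · rintro (rfl | ⟨hwX, hwx, hwy⟩)
      · exact ⟨hxy.symm, hyX⟩
      · exact ⟨hwx, hwX⟩
  have eXy : X.erase y = insert x (X \ {x, y}) := by
    ext w; simp only [mem_erase, mem_insert, mem_sdiff, mem_singleton, not_or]
    constructor
    · rintro ⟨hwy, hwX⟩
      by_cases hwx : w = x
      · exact Or.inl hwx
      · exact Or.inr ⟨hwX, hwx, hwy⟩
    · rintro (rfl | ⟨hwX, hwx, hwy⟩)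
      · exact ⟨hxy, hxX⟩
      · exact ⟨hwy, hwX⟩
  have hsub := rk_inter_add_rk_union_le' (M := N) (insert x (X \ {x, y})) (insert y (X \ {x, y}))
  have eI : insert x (X \ {x, y}) ∩ insert y (X \ {x, y}) = X \ {x, y} := by
    ext w; simp only [mem_inter, mem_insert, mem_sdiff, mem_singleton, not_or]
    constructor
    · rintro ⟨h1 | h1, h2 | h2⟩
      · exact absurd (h1.symm.trans h2) hxy
      · exact h2
      · exact h1
      · exact h1
    · intro hw; exact ⟨Or.inr hw, Or.inr hw⟩
  have eU : insert x (X \ {x, y}) ∪ insert y (X \ {x, y}) = X := by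
    ext w; simp only [mem_union, mem_insert, mem_sdiff, mem_singleton, not_or]
    constructor
    · rintro ((rfl | hw) | (rfl | hw))
      · exact hxX
      · exact hw.1
      · exact hyX
      · exact hw.1
    · intro hw
      by_cases hwx : w = x
      · exact Or.inl (Or.inl hwx)
      by_cases hwy : w = y
      · exact Or.inr (Or.inl hwy)
      exact Or.inl (Or.inr ⟨hw, hwx, hwy⟩)
  rw [eI, eU, hS3, hX] at hsub
  have hxle : rk N (insert x (X \ {x, y})) ≤ 4 := by
    have := rk_le_card' (M := N) (insert x (X \ {x, y}))
    rw [card_insert_of_notMem hxS, hSc] at this; exact this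
  have hyle : rk N (insert y (X \ {x, y})) ≤ 4 := by
    have := rk_le_card' (M := N) (insert y (X \ {x, y}))
    rw [card_insert_of_notMem hyS, hSc] at this; exact this
  by_cases hx4 : rk N (insert y (X \ {x, y})) = 4
  · exact ⟨x, mem_insert_self _ _, hefx, by rw [eXx]; exact hx4, hoffx⟩
  · refine ⟨y, mem_insert_of_mem (mem_singleton_self _), hefy, ?_, hoffy⟩
    rw [eXy]; omega

/-- **INJECTIVITY OF RULE R3**: two distinct demands `{x, y₁} + e`, `{x, y₂} + e` whose complements `X ∖ π` are
both ON cannot share the point `x` with `ρ(X − x) = 4`: the complements `{y₂} ∪ W`, `{y₁} ∪ W`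
(`W := X − x − y₁ − y₂`) have union `X − x` of rank `4`, so F1′ forces `ρ(W) ≤ 1` and `ρ(X − x) ≤ 3`. -/
theorem r3_injective (h : SeriesPair N b b') (hR : rk N (gr N) = 5)
    (hnl : ∀ S : Finset α, S ⊆ ((gr N).erase b).erase b' → rk N (insert b (insert b' S)) ≤ 3 → rk N S ≤ 1)
    {e f x y₁ y₂ : α} (hy : y₁ ≠ y₂)
    (hy₁ : y₁ ∈ ((((gr N).erase b).erase b').erase f).erase e) (hy₂ : y₂ ∈ ((((gr N).erase b).erase b').erase f).erase e)
    (hcon₁ : rk N (insert b (insert b' (((((gr N).erase b).erase b').erase f).erase e \ {x, y₁}))) = 4)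
    (hcon₂ : rk N (insert b (insert b' (((((gr N).erase b).erase b').erase f).erase e \ {x, y₂}))) = 4)
    (hx4 : rk N ((((((gr N).erase b).erase b').erase f).erase e).erase x) = 4) : False := by
  set X := ((((gr N).erase b).erase b').erase f).erase e with hXdef
  have hXE : X ⊆ ((gr N).erase b).erase b' := (erase_subset _ _).trans (erase_subset _ _)
  have hXg : X ⊆ gr N := hXE.trans ((erase_subset _ _).trans (erase_subset _ _))
  have eU : X \ {x, y₁} ∪ X \ {x, y₂} = X.erase x := by
    ext w; simp only [mem_union, mem_sdiff, mem_insert, mem_singleton, not_or, mem_erase]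
    constructor
    · rintro (⟨hw, h1, h2⟩ | ⟨hw, h1, h2⟩) <;> exact ⟨h1, hw⟩
    · rintro ⟨hwx, hw⟩
      by_cases h1 : w = y₁
      · exact Or.inr ⟨hw, hwx, h1 ▸ hy⟩
      · exact Or.inl ⟨hw, hwx, h1⟩
  have hU : rk N (X \ {x, y₁} ∪ X \ {x, y₂}) = 4 := by rw [eU]; exact hx4
  have hI := rk_inter_le_one_of_two_on h hR hnl (sdiff_subset.trans hXE) (sdiff_subset.trans hXE) hcon₁ hcon₂ hU
  have eI : X \ {x, y₁} ∩ (X \ {x, y₂}) = (X.erase x) \ {y₁, y₂} := by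
    ext w; simp only [mem_inter, mem_sdiff, mem_insert, mem_singleton, not_or, mem_erase]
    tauto
  rw [eI] at hI
  -- `X − x ⊆ (X − x − y₁ − y₂) + y₁ + y₂` has rank `≤ ρ(W) + 2`
  have hsub : X.erase x ⊆ insert y₁ (insert y₂ ((X.erase x) \ {y₁, y₂})) := by
    intro w hw
    simp only [mem_insert, mem_sdiff, mem_singleton, not_or]
    by_cases h1 : w = y₁
    · exact Or.inl h1
    by_cases h2 : w = y₂
    · exact Or.inr (Or.inl h2)
    exact Or.inr (Or.inr ⟨hw, h1, h2⟩)
  have h1 : rk N (insert y₂ ((X.erase x) \ {y₁, y₂})) ≤ rk N ((X.erase x) \ {y₁, y₂}) + 1 :=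
    rk_insert_le_add_one (hXg hy₂) (sdiff_subset.trans ((erase_subset _ _).trans hXg))
  have h2 : rk N (insert y₁ (insert y₂ ((X.erase x) \ {y₁, y₂}))) ≤ rk N (insert y₂ ((X.erase x) \ {y₁, y₂})) + 1 :=
    rk_insert_le_add_one (hXg hy₁) (insert_subset (hXg hy₂) (sdiff_subset.trans ((erase_subset _ _).trans hXg)))
  have h3 : rk N (X.erase x) ≤ rk N (insert y₁ (insert y₂ ((X.erase x) \ {y₁, y₂}))) := rk_mono' (M := N) hsub
  omega

end StarSharpD0B

end PercRepro.Cogirth
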